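import Literature.IUT.LogVolume.SubThetaFieldRamificationTateUnramified
import Literature.NumberTheory.EllipticCurves.SemistableModPImageMultiplicativeProofs
import Literature.NumberTheory.EllipticCurves.WeilPairingProofs
import HarnessLib

/-!
# Lemmas for the WILD local type of a field pinned by the v3 Θ-datum (`v ∣ p ∈ {3, 5}`): the kernel of `ρ̄_{E,p}` fixes
# `μ_p`, Serre's line gives unipotence and an index `∣ p − 1`, and `√−3 = 2ζ₃ + 1`, `√5 = 2(ζ₅ + ζ₅⁻¹) + 1` (proof-only)

J.-P. Serre, *Propriétés galoisiennes des points d'ordre fini des courbes elliptiques*, Invent. Math. **15** (1972),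
§1.11 (`det ρ̄_p = χ̄_p` by the Weil pairing) and §1.12, Cor. of Prop. 13 (at a multiplicative place `v ∣ p` the inertia
group acts on `E[p]` through `(χ *; 0 1)`); J. H. Silverman, *AEC* III.8.1 (the Weil pairing). Companion of
`SubThetaFieldRamificationWild` (abc-iut R-W GAP G-Wnum2-1 (i), upper half), which assembles these into
`e(w | v) ∣ p(p − 1)·p′` at the wild bad places. THIS FILE (classical; no definition, no named fact) proves:

* `WeierstrassCurve.smul_eq_of_pow_prime_eq_one_of_mem_ker_galoisRepTorsion` — **`ker ρ̄_{E,p}` fixes the `p`-th roots of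
  unity** (`ζ = e_p(S, T)` for the tree's Weil pairing `exists_weilPairing_holds`, and `σζ = e_p(σS, σT)`);
* `WeierstrassCurve.galoisRepTorsion_pow_eq_one_of_sub_mem_of_forall_smul_eq` — if `σ` moves `E[p]` into a subgroup `X`
  that it fixes pointwise then `ρ̄_{E,p}(σ)^p = 1`;
* (private) `natCard_addAut_dvd_sub_one_of_card_dvd_prime` — `#Aut(X) ∣ p − 1` for an additive group of order `∣ p`;
* `WeierstrassCurve.natCard_map_galoisRepTorsion_dvd_of_forall_pow_eq_one_of_dvd` — exponent `k ∣ q` on `J` ⇒ `#ρ̄_{E,q}(J) ∣ k`;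
* `WeierstrassCurve.exists_subgroup_fixing_relIndex_dvd` — the pointwise fixer `A` of a `J`-stable `X ≤ E[p]` with
  `#X ∣ p` has `[J : A] ∣ p − 1` (`J` acts on `X` through `Aut(X)`);
* `Cor22.smul_eq_of_sq_eq_neg_three`, `Cor22.smul_eq_of_sq_eq_five` — an automorphism fixing `μ_3` (resp. `μ_5`) fixes
  every square root of `−3` (resp. `5`); `Cor22.smul_eq_of_sq_eq_of_valuation_mul_eq_exp_even` — inertia fixes `√a`
  when `ord_v(a·b)` is even and it fixes `√b`.

Nothing here is disputed mathematics; TAKES NO SIDE on [IUTchIII] Cor. 3.12.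
-/

noncomputable section

open scoped Classical

/-! ## §0. Three pieces of classical input -/

namespace WeierstrassCurve

open NumberField Field Literature.NumberTheory.EllipticCurves Literature.NumberTheory.GaloisRepresentations

variable {K : Type} [Field K] [NumberField K] (W : WeierstrassCurve K)

/-- **The kernel of `ρ̄_{E,p}` fixes the `p`-th roots of unity** (`E` elliptic over a number field, `p` prime): by the
Weil pairing (`exists_weilPairing_holds`: bilinear, alternating, non-degenerate, Galois-equivariant), `ζ = e_p(S, T)` is a
primitive `p`-th root of unity for suitable `S, T ∈ E[p]`, and `σζ = e_p(σS, σT) = ζ` when `σ` fixes `E[p]`; every `p`-th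
root of unity is a power of `ζ`. («le déterminant de la représentation de `G` dans `E_p` est égal au caractère donnant
l'action de `G` sur `μ_p`».) [cite: Serre1972, §1.11] [cite: SilvermanAEC2009, Prop. III.8.1] -/
theorem smul_eq_of_pow_prime_eq_one_of_mem_ker_galoisRepTorsion [W.IsElliptic] {p : ℕ} (hp : p.Prime)
    {σ : absoluteGaloisGroup K} (hσ : σ ∈ (W.galoisRepTorsion (p : ℤ)).ker)
    {ζ : AlgebraicClosure K} (hζ : ζ ^ p = 1) : σ • ζ = ζ := by
  haveI : Fact p.Prime := ⟨hp⟩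
  haveI : NeZero (p : K) := ⟨Nat.cast_ne_zero.mpr hp.ne_zero⟩
  obtain ⟨e, hpow, haddl, haddr, halt, hnd, hgal⟩ :=
    (exists_weilPairing_holds W p) hp.two_le (NeZero.ne (p : K))
  -- a nonzero `p`-torsion point `T`, and `S` with `e S T ≠ 1`
  have hcard : Nat.card (geomTorsion W (p : ℤ)) = p ^ 2 :=
    Literature.NumberTheory.EllipticCurves.natCard_geomTorsion W p
  haveI : Finite (geomTorsion W (p : ℤ)) := Nat.finite_of_card_ne_zero (by rw [hcard]; exact pow_ne_zero _ hp.ne_zero)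
  have h1 : 1 < Nat.card (geomTorsion W (p : ℤ)) := by
    rw [hcard]; exact Nat.one_lt_pow two_ne_zero hp.one_lt
  obtain ⟨T, hT⟩ : ∃ T : geomTorsion W (p : ℤ), T ≠ 0 := by
    obtain ⟨a, b, hab⟩ := Finite.one_lt_card_iff_nontrivial.mp h1
    by_cases ha : a = 0
    · exact ⟨b, fun hb => hab (ha.trans hb.symm)⟩
    · exact ⟨a, ha⟩
  obtain ⟨S, hS⟩ : ∃ S, e S T ≠ 1 := by
    by_contra hcon
    push Not at hcon
    exact hT (hnd T hcon)
  -- `ζ₀ = e S T` is a primitive `p`-th root of unity fixed by `σ`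
  set ζ₀ := e S T with hζ₀
  have hζ₀p : ζ₀ ^ p = 1 := hpow S T
  have hprim : IsPrimitiveRoot ζ₀ p := by
    have hord : orderOf ζ₀ = p := orderOf_eq_prime hζ₀p hS
    rw [← hord]
    exact IsPrimitiveRoot.orderOf ζ₀
  have hσS : σ • S = S := by
    have h := galoisRepTorsion_apply W (p : ℤ) σ S
    rw [(MonoidHom.mem_ker).1 hσ] at h
    exact h.symm
  have hσT : σ • T = T := by
    have h := galoisRepTorsion_apply W (p : ℤ) σ T
    rw [(MonoidHom.mem_ker).1 hσ] at h
    exact h.symm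
  have hσζ₀ : σ • ζ₀ = ζ₀ := by rw [hζ₀, hgal σ S T, hσS, hσT]
  obtain ⟨i, -, rfl⟩ := hprim.eq_pow_of_pow_eq_one hζ
  rw [smul_pow', hσζ₀]

omit [NumberField K] in
/-- **Unipotence from Serre's line**: if `σ` moves `E[p]` into a subgroup `X ≤ E[p]` (`σP − P ∈ X`) and fixes `X`
pointwise, then `ρ̄_{E,p}(σ)^p = 1` (`(g − 1)² = 0`; the tree's `galoisRepTorsion_pow_eq_one_of_unipotent`).
[cite: Serre1972, §1.12, Cor. of Prop. 13] -/
theorem galoisRepTorsion_pow_eq_one_of_sub_mem_of_forall_smul_eq [W.IsElliptic] {p : ℕ}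
    (X : AddSubgroup (geomTorsion W (p : ℤ))) {σ : absoluteGaloisGroup K}
    (h1 : ∀ P : geomTorsion W (p : ℤ), σ • P - P ∈ X) (h2 : ∀ x ∈ X, σ • x = x) :
    W.galoisRepTorsion (p : ℤ) σ ^ p = 1 :=
  W.galoisRepTorsion_pow_eq_one_of_unipotent fun Q => h2 _ (h1 Q)

/-- **The automorphism group of a group of order dividing a prime `p` has order dividing `p − 1`** (`X = 0` or
`X ≃ ℤ/pℤ`, `Aut(ℤ/pℤ) ≅ (ℤ/pℤ)ˣ`). [folklore] -/
private theorem natCard_addAut_dvd_sub_one_of_card_dvd_prime {X : Type*} [AddCommGroup X] {p : ℕ} (hp : p.Prime)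
    (hX : Nat.card X ∣ p) : Nat.card (AddAut X) ∣ p - 1 := by
  haveI : Fact p.Prime := ⟨hp⟩
  rcases (Nat.dvd_prime hp).mp hX with h1 | hcard
  · -- `X` trivial
    haveI : Finite X := Nat.finite_of_card_ne_zero (by rw [h1]; exact one_ne_zero)
    haveI : Subsingleton X := (Nat.card_eq_one_iff_unique.mp h1).1
    haveI : Subsingleton (AddAut X) := ⟨fun f g => AddEquiv.ext fun x => Subsingleton.elim _ _⟩
    rw [Nat.card_of_subsingleton (AddEquiv.refl X : AddAut X)]
    exact one_dvd _
  · have hcyc : IsAddCyclic X := isAddCyclic_of_prime_card hcard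
    let e₁ : ZMod p ≃+ X := by
      have e := zmodAddCyclicAddEquiv hcyc
      rwa [hcard] at e
    have hcardAut : Nat.card (AddAut X) = Nat.card (AddAut (ZMod p)) := Nat.card_congr (AddAut.congr e₁).symm.toEquiv
    rw [hcardAut, Nat.card_congr (ZMod.AddAutEquivUnits p).toEquiv, Nat.card_congr Additive.toMul,
      Nat.card_eq_fintype_card, ZMod.card_units_eq_totient, Nat.totient_prime hp]

/-- **Image of order dividing `k ∣ q`**: if `ρ̄_{E,q}` (`q` prime) has exponent dividing `k` on `J ≤ Γ_K` with `k ∣ q`,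
the image `ρ̄_{E,q}(J)` has order dividing `k` (`k = 1`: trivial image; `k = q`: the tree's
`natCard_map_galoisRepTorsion_dvd_of_forall_pow_eq_one`). [cite: Serre1972, §1.11–§1.12] -/
theorem natCard_map_galoisRepTorsion_dvd_of_forall_pow_eq_one_of_dvd [W.IsElliptic] {q k : ℕ} (hq : q.Prime)
    (hk : k ∣ q) (J : Subgroup (absoluteGaloisGroup K)) (hJ : ∀ σ ∈ J, W.galoisRepTorsion (q : ℤ) σ ^ k = 1) :
    Nat.card (J.map (W.galoisRepTorsion (q : ℤ))) ∣ k := by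
  rcases (Nat.dvd_prime hq).mp hk with rfl | rfl
  · have hbot : J.map (W.galoisRepTorsion (q : ℤ)) = ⊥ := by
      rw [Subgroup.map_eq_bot_iff]
      intro σ hσ
      rw [MonoidHom.mem_ker, ← pow_one (W.galoisRepTorsion (q : ℤ) σ)]
      exact hJ σ hσ
    rw [hbot, Subgroup.card_bot]
  · exact W.natCard_map_galoisRepTorsion_dvd_of_forall_pow_eq_one hq J hJ

omit [NumberField K] in
/-- **The pointwise fixer of an invariant subgroup `X ≤ E[p]` of order dividing `p` has index dividing `p − 1`** in any
`J ≤ Γ_K` stabilising `X`: `J` acts on `X` through `Aut(X)`, a group of order dividing `p − 1`.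
[cite: Serre1972, §1.12, Cor. of Prop. 13] -/
theorem exists_subgroup_fixing_relIndex_dvd {p : ℕ} (hp : p.Prime)
    (X : AddSubgroup (geomTorsion W (p : ℤ))) (hX : Nat.card X ∣ p)
    (J : Subgroup (absoluteGaloisGroup K)) (hJ : ∀ σ ∈ J, ∀ x ∈ X, σ • x ∈ X) :
    ∃ A : Subgroup (absoluteGaloisGroup K), A ≤ J ∧ A.relIndex J ∣ p - 1 ∧
      (∀ σ ∈ A, ∀ x ∈ X, σ • x = x) ∧ (∀ σ ∈ J, (∀ x ∈ X, σ • x = x) → σ ∈ A) := by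
  -- the restricted action of `J` on `X`
  letI act : DistribMulAction J X :=
    { smul := fun σ x => ⟨(σ : absoluteGaloisGroup K) • (x : geomTorsion W (p : ℤ)), hJ σ σ.2 x x.2⟩
      one_smul := fun x => Subtype.ext (one_smul (absoluteGaloisGroup K) (x : geomTorsion W (p : ℤ)))
      mul_smul := fun σ τ x =>
        Subtype.ext (mul_smul (σ : absoluteGaloisGroup K) (τ : absoluteGaloisGroup K) (x : geomTorsion W (p : ℤ)))
      smul_zero := fun σ => Subtype.ext (smul_zero (σ : absoluteGaloisGroup K))
      smul_add := fun σ x y =>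
        Subtype.ext (smul_add (σ : absoluteGaloisGroup K) (x : geomTorsion W (p : ℤ)) (y : geomTorsion W (p : ℤ))) }
  have hsmul : ∀ (σ : J) (x : X), ((σ • x : X) : geomTorsion W (p : ℤ)) = (σ : absoluteGaloisGroup K) • (x : _) :=
    fun _ _ => rfl
  let θ : J →* Multiplicative (AddAut X) := DistribMulAction.toAddAut J X
  have hθ : ∀ (σ : J) (x : X), (DistribMulAction.toAddAut J X σ : X ≃+ X) x = σ • x := fun σ x => rfl
  have hker : ∀ σ : J, σ ∈ θ.ker ↔ ∀ x ∈ X, (σ : absoluteGaloisGroup K) • x = x := by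
    intro σ
    rw [MonoidHom.mem_ker]
    constructor
    · intro h x hx
      rw [← map_one θ] at h
      have h1 : (Multiplicative.toAdd (θ σ)) ⟨x, hx⟩ = (Multiplicative.toAdd (θ 1)) ⟨x, hx⟩ := by rw [h]
      rw [hθ, hθ, one_smul] at h1
      have h2 := congrArg Subtype.val h1
      rwa [hsmul] at h2
    · intro h
      rw [← map_one θ]
      apply Multiplicative.toAdd.injective
      refine AddEquiv.ext fun x => ?_
      rw [hθ, hθ, one_smul]
      exact Subtype.ext (by rw [hsmul]; exact h x x.2)
  refine ⟨θ.ker.map J.subtype, Subgroup.map_subtype_le _, ?_, ?_, ?_⟩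
  · -- `[J : ker θ] = #θ(J) ∣ #Aut(X) ∣ p − 1`
    rw [Subgroup.relIndex, ← Subgroup.comap_subtype, Subgroup.comap_map_eq_self_of_injective J.subtype_injective,
      Subgroup.index_ker]
    have h1 : Nat.card θ.range ∣ Nat.card (Multiplicative (AddAut X)) := Subgroup.card_subgroup_dvd_card θ.range
    have h2 : Nat.card (Multiplicative (AddAut X)) = Nat.card (AddAut X) := Nat.card_congr Multiplicative.toAdd
    rw [h2] at h1
    exact h1.trans (natCard_addAut_dvd_sub_one_of_card_dvd_prime hp hX)
  · intro σ hσ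
    obtain ⟨τ, hτ, rfl⟩ := Subgroup.mem_map.mp hσ
    exact (hker τ).mp hτ
  · intro σ hσJ hfix
    exact Subgroup.mem_map.mpr ⟨⟨σ, hσJ⟩, (hker ⟨σ, hσJ⟩).mpr hfix, rfl⟩

end WeierstrassCurve

namespace Literature.IUT.LogVolume

namespace Cor22

open NumberField IsDedekindDomain Literature.NumberTheory.DiophantineGeometry.GenEll
open Literature.NumberTheory.EllipticCurves Literature.NumberTheory.GaloisRepresentations
open Literature.NumberTheory.NumberFields WeierstrassCurve IntermediateField Field

/-! ## §0b. Square roots fixed through the `p`-th roots of unity (`p = 3, 5`) and through even order -/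

section Sqrt

variable {K : Type} [Field K] [NumberField K]

/-- `√−3 = 2ζ₃ + 1`: an automorphism fixing the cube roots of unity fixes every square root of `−3`.
[cite: NeukirchANT1999, Ch. I §10 (cyclotomic fields: the quadratic subfield ℚ(√p*) ⊆ ℚ(ζ_p)), p = 3] -/
theorem smul_eq_of_sq_eq_neg_three {σ : absoluteGaloisGroup K}
    (h : ∀ ζ : AlgebraicClosure K, ζ ^ 3 = 1 → σ • ζ = ζ) {z : AlgebraicClosure K}
    (hz : z ^ 2 = algebraMap K (AlgebraicClosure K) (-3)) : σ • z = z := by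
  rw [map_neg, map_ofNat] at hz
  set ζ : AlgebraicClosure K := (z - 1) / 2 with hζdef
  have h2 : (2 : AlgebraicClosure K) ≠ 0 := two_ne_zero
  have hζ3 : ζ ^ 3 = 1 := by
    rw [hζdef]
    field_simp
    linear_combination (z - 3) * hz
  have hzζ : z = 2 * ζ + 1 := by rw [hζdef]; field_simp; ring
  have hσζ := h ζ hζ3
  rw [hzζ, absoluteGaloisGroup.smul_def, map_add, map_mul, map_ofNat, map_one,
    ← absoluteGaloisGroup.smul_def, hσζ]

/-- `√5 = 2(ζ₅ + ζ₅⁻¹) + 1`: an automorphism fixing the fifth roots of unity fixes every square root of `5`.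
[cite: NeukirchANT1999, Ch. I §10 (cyclotomic fields: the quadratic subfield ℚ(√p*) ⊆ ℚ(ζ_p)), p = 5] -/
theorem smul_eq_of_sq_eq_five {σ : absoluteGaloisGroup K}
    (h : ∀ ζ : AlgebraicClosure K, ζ ^ 5 = 1 → σ • ζ = ζ) {z : AlgebraicClosure K}
    (hz : z ^ 2 = algebraMap K (AlgebraicClosure K) 5) : σ • z = z := by
  rw [map_ofNat] at hz
  set x : AlgebraicClosure K := (z - 1) / 2 with hxdef
  have h2 : (2 : AlgebraicClosure K) ≠ 0 := two_ne_zero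
  have hx : x ^ 2 + x - 1 = 0 := by
    rw [hxdef]
    field_simp
    linear_combination hz
  -- `ζ` a root of `T² − x T + 1` (quadratic formula in the algebraic closure): then `ζ⁵ = 1` and `x = ζ + ζ⁻¹`
  obtain ⟨w, hw⟩ := IsAlgClosed.exists_pow_nat_eq (x ^ 2 - 4) two_pos
  set ζ : AlgebraicClosure K := (x + w) / 2 with hζdef
  have hζ : ζ ^ 2 - x * ζ + 1 = 0 := by
    rw [hζdef]
    field_simp
    linear_combination hw
  have hζ0 : ζ ≠ 0 := by
    intro h0
    rw [h0] at hζ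
    norm_num at hζ
  have hζ5 : ζ ^ 5 = 1 := by
    linear_combination (ζ - 1) * (ζ ^ 2 + (x + 1) * ζ + 1) * hζ + (ζ - 1) * ζ ^ 2 * hx
  have hxζ' : x * ζ = ζ ^ 2 + 1 := by linear_combination -hζ
  have hxζ : x = ζ + ζ⁻¹ := by
    field_simp
    linear_combination hxζ'
  have hσx : σ • x = x := by
    rw [hxζ, absoluteGaloisGroup.smul_def, map_add, map_inv₀, ← absoluteGaloisGroup.smul_def, h ζ hζ5]
  have hzx : z = 2 * x + 1 := by rw [hxdef]; field_simp; ring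
  rw [hzx, absoluteGaloisGroup.smul_def, map_add, map_mul, map_ofNat, map_one,
    ← absoluteGaloisGroup.smul_def, hσx]

/-- **Square roots with a partner of even order are fixed by inertia**: if `ord_v(a·b)` is even (`v ∤ 2`) and `σ ∈ I_𝔓`
fixes every square root of `b ≠ 0`, then `σ` fixes every square root of `a` (`√a = √(ab)/√b`, and inertia fixes the
square roots of elements of even order, the tree's `smul_eq_of_mem_inertia_of_sq_eq_of_valuation_eq_exp_even`).
[cite: NeukirchANT1999, Ch. II Prop. (7.13)] -/
theorem smul_eq_of_sq_eq_of_valuation_mul_eq_exp_even (v : HeightOneSpectrum (𝓞 K))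
    {𝔓 : Ideal (absIntegers (𝓞 K) K)} (h𝔓 : 𝔓 ∈ v.primesAbove) {σ : absoluteGaloisGroup K}
    (hσ : σ ∈ 𝔓.inertia (absoluteGaloisGroup K)) (h2 : (2 : 𝓞 K) ∉ v.asIdeal) {a b : K} (hb : b ≠ 0) {k : ℤ}
    (hab : v.valuation K (a * b) = WithZero.exp (2 * k))
    (hσb : ∀ z₀ : AlgebraicClosure K, z₀ ^ 2 = algebraMap K (AlgebraicClosure K) b → σ • z₀ = z₀)
    {z : AlgebraicClosure K} (hz : z ^ 2 = algebraMap K (AlgebraicClosure K) a) : σ • z = z := by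
  obtain ⟨z₀, hz₀⟩ := IsAlgClosed.exists_pow_nat_eq (algebraMap K (AlgebraicClosure K) b) two_pos
  have hz₀0 : z₀ ≠ 0 := by
    intro h0
    rw [h0, zero_pow two_ne_zero] at hz₀
    exact hb ((map_eq_zero_iff _ (algebraMap K (AlgebraicClosure K)).injective).mp hz₀.symm)
  have hprod : (z * z₀) ^ 2 = algebraMap K (AlgebraicClosure K) (a * b) := by rw [mul_pow, hz, hz₀, map_mul]
  have hfix := smul_eq_of_mem_inertia_of_sq_eq_of_valuation_eq_exp_even v h𝔓 hσ h2 hab hprod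
  rw [smul_mul', hσb z₀ hz₀] at hfix
  exact mul_right_cancel₀ hz₀0 hfix

end Sqrt

end Cor22

end Literature.IUT.LogVolume

end
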